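import Literature.NumberTheory.LFunctions.BondarenkoHeap2026Sections3to5
import Literature.NumberTheory.LFunctions.ExplicitDeuringHeilbronnDirichlet
import Literature.NumberTheory.LFunctions.ZetaRealAxis
import HarnessLib

/-!
# Explicit log-free zero-density estimates for Dirichlet `L`-functions, with Bombieri's
# exceptional-zero refinement (Thorner–Zaman 2024, Theorem 1.2 and Corollary 6.1)

Topic `Literature/NumberTheory/LFunctions` (namespace `Literature.NumberTheory.LFunctions`; the
paper's objects in the sub-namespace `ThornerZaman2024`). STATEMENT LAYER for the cell
`parity-realchar` (SIEGEL INSTRUMENT, D-0070 deliverable (3): "Deuring–Heilbronn repulsion in its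
explicit forms" — here the DENSITY form: Bombieri's refinement of Gallagher's log-free estimate, in
which a Landau–Siegel zero `β₁(Q)` close to `1` SHRINKS the count of all other zeros by the factor
`(1 − β₁(Q)) log Q`). Source: J. Thorner, A. Zaman, *An explicit version of Bombieri's log-free
density estimate and Sárközy's theorem for shifted primes*, Forum Math. 36 (2024) 1059–1080
[ThornerZaman2024LogFree], §1 (Theorem 1.2 with the displays defining `𝓛(s,Q)`, `β₁(Q)`, `N(σ,Q)`,
`N*(σ,Q)`) and §6 (Corollary 6.1), read from the held copy arXiv:2208.11123.

The paper's objects (p. 2): for `Q ≥ 3` and `σ ≥ 0`,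
`𝓛(s,Q) := ∏_{1 ≤ q ≤ Q} ∏_{χ mod q primitive} L(s,χ)`,
`β₁(Q) := max{β ∈ ℝ : 𝓛(β,Q) = 0}`,
`N(σ,Q) := #{ρ = β + iγ : β > σ, |γ| ≤ Q, 𝓛(ρ,Q) = 0}`,
`N*(σ,Q) := #{ρ = β + iγ ≠ β₁(Q) : β > σ, |γ| ≤ Q, 𝓛(ρ,Q) = 0}`
("All sums and counts over `ρ` weigh the contribution for each `ρ` with its multiplicity.") They are
rendered with the tree's per-character zero count of exactly this shape,
`BondarenkoHeap2026.charZeroCountRe χ σ H = #{ρ : L(ρ,χ) = 0, Re ρ > σ, |Im ρ| ≤ H}` (with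
multiplicity `DirichletDisc.zeroOrder χ ρ = analyticOrderNatAt`), summed over the primitive
characters of each modulus `q = i + 1 ≤ ⌊Q⌋` (the modulus `1` contributes `ζ`, as in print);
`β₁(Q)` is the `sSup` of the set of real zeros (a maximum in print: the set is nonempty — `ζ(−2) = 0`
— bounded above by `1`, and locally finite).

## Contents

* `ThornerZaman2024.realZeroSet`, `.betaOne`, `.zeroCount`, `.zeroCountExcl` — the objects above.
* `thornerZaman2024_theorem12` — **Theorem 1.2** (NAMED FACT, as printed): for `Q ≥ 3`, `σ ≥ 39/40`,
  `N(σ,Q) ≤ 10^88 (10^421 Q^99)^{1−σ}` and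
  `N*(σ,Q) ≤ 10^93 · min{1, (1 − β₁(Q)) log Q} · (10^466 Q^170)^{1−σ}`.
* `thornerZaman2024_corollary61` — **Corollary 6.1** (NAMED FACT, as printed): the same for all
  `σ ≥ 0` with exponents `127` and `198`.
* Index only (not typed, no new hypothesis shape): Theorem 2.15 (the paper's explicit Deuring–Heilbronn
  repulsion `β ≤ 1 − log(1/((1−β₁(Q))(670 564.676 + 347 029.502 log Q + 107 906.278 log T)))/(104.645 +
  54.156 log Q + 16.84 log T)`, superseded by Benli–Goel–Twiss–Zaman's Corollary 1.1 =
  `BGTZ2025.corollary11` of `ExplicitDeuringHeilbronnDirichlet.lean`); Theorem 2.6 (zero-free region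
  for `𝓛(s,Q)` except `β₁(Q)` with `c = 1/9.645908801`, McCurley + Platt — cf. the tree's
  `McCurley1984_theorem1`, `ZeroFreeRegionUpTo`); Proposition 2.10 (= `BGTZ2025.proposition24_thornerZaman`).

WHAT THIS IS NOT: nothing is proved here about `N(σ,Q)`; the inexplicit forms ARE proved in the tree
(`logFreeDensity_dirichlet`, Bombieri's Théorème 14 `logFreeDensityDH`, one character at a time with
the tree's `charZeroCount`); this file records the printed numerical constants only. No instance, no
notation. Nothing here bears on parity.
-/

noncomputable section

open scoped Classical

namespace Literature.NumberTheory.LFunctions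

namespace ThornerZaman2024

open BondarenkoHeap2026 (zeroSetRe charZeroCountRe)
open DirichletDisc (zeroOrder)

/-- The real zeros of `𝓛(s,Q) = ∏_{1 ≤ q ≤ Q} ∏_{χ mod q primitive} L(s,χ)`: the reals `β` with
`L(β, χ) = 0` for some primitive `χ` of some modulus `q = i + 1 ≤ ⌊Q⌋` (modulus `1` = `ζ`, so the
trivial zeros `−2, −4, …` of `ζ` belong to it and the set is nonempty once `Q ≥ 1`).
[cite: ThornerZaman2024LogFree, §1 (display defining 𝓛(s,Q) and β₁(Q), before Theorem 1.2)] -/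
def realZeroSet (Q : ℝ) : Set ℝ :=
  {β | ∃ i : ℕ, i < ⌊Q⌋₊ ∧ ∃ χ : DirichletCharacter ℂ (i + 1), χ.IsPrimitive ∧ χ.LFunction β = 0}

/-- `β₁(Q) := max{β ∈ ℝ : 𝓛(β,Q) = 0}`, rendered as the supremum of `realZeroSet Q` (a maximum in
print; "If `Q ≥ 5`, then `𝓛(0,Q) = 0` and `𝓛(σ,Q) ≠ 0` for `σ ≥ 1`. Thus `β₁(Q) ∈ [0,1)`", Remark
after Theorem 1.2). [cite: ThornerZaman2024LogFree, §1 (display defining β₁(Q)) and Remark after Theorem 1.2] -/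
def betaOne (Q : ℝ) : ℝ :=
  sSup (realZeroSet Q)

/-- `N(σ,Q) := #{ρ = β + iγ : β > σ, |γ| ≤ Q, 𝓛(ρ,Q) = 0}` with multiplicity: the sum over the
moduli `q = i + 1 ≤ ⌊Q⌋` and the primitive `χ` mod `q` of the tree's
`charZeroCountRe χ σ Q = #{ρ : L(ρ,χ) = 0, Re ρ > σ, |Im ρ| ≤ Q}` (multiplicities by
`analyticOrderNatAt`). [cite: ThornerZaman2024LogFree, §1 (display defining N(σ,Q))] -/
def zeroCount (σ Q : ℝ) : ℕ :=
  ∑ i ∈ Finset.range ⌊Q⌋₊, ∑ χ : DirichletCharacter ℂ (i + 1),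
    if χ.IsPrimitive then charZeroCountRe χ σ Q else 0

/-- `N*(σ,Q) := #{ρ = β + iγ ≠ β₁(Q) : β > σ, |γ| ≤ Q, 𝓛(ρ,Q) = 0}` with multiplicity: as
`zeroCount`, the point `β₁(Q)` being removed from every character's zero set.
[cite: ThornerZaman2024LogFree, §1 (display defining N*(σ,Q))] -/
def zeroCountExcl (σ Q : ℝ) : ℕ :=
  ∑ i ∈ Finset.range ⌊Q⌋₊, ∑ χ : DirichletCharacter ℂ (i + 1),
    if χ.IsPrimitive then ∑ᶠ ρ ∈ zeroSetRe χ σ Q \ {((betaOne Q : ℝ) : ℂ)}, zeroOrder χ ρ else 0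

/-- `N*(σ,Q)` and `N(σ,Q)` agree character by character except for the removed point: the summand
of `zeroCountExcl` is the `finsum` of the multiplicity over `zeroSetRe χ σ Q ∖ {β₁(Q)}`, that of
`zeroCount` over `zeroSetRe χ σ Q` (definition unfolding, for the reader of the two renderings).
[cite: ThornerZaman2024LogFree, §1 (display defining N(σ,Q), N*(σ,Q))] -/
theorem zeroCount_eq (σ Q : ℝ) :
    zeroCount σ Q = ∑ i ∈ Finset.range ⌊Q⌋₊, ∑ χ : DirichletCharacter ℂ (i + 1),
      if χ.IsPrimitive then ∑ᶠ ρ ∈ zeroSetRe χ σ Q, zeroOrder χ ρ else 0 :=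
  rfl

end ThornerZaman2024

open ThornerZaman2024

/-- **Thorner–Zaman 2024, Theorem 1.2 (NAMED FACT, as printed).** "Let `Q ≥ 3` and `σ ≥ 39/40`.
If `N(σ,Q)` and `N*(σ,Q)` are as in (1.2), then
`N(σ,Q) ≤ 10^{88} (10^{421} Q^{99})^{1−σ}`, `N*(σ,Q) ≤ 10^{93} min{1, (1 − β₁(Q)) log Q} (10^{466} Q^{170})^{1−σ}`."
The first is an explicit Gallagher log-free estimate; the second is the explicit form of Bombieri's
refinement `N* ≤ c (1 − β₁(Q))(log Q) Q^{c'(1−σ)}` — the Deuring–Heilbronn phenomenon in density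
form: a real zero `β₁(Q)` very close to `1` forces all OTHER zeros of all primitive `L(s,χ)`,
`q ≤ Q`, out of the region `β > σ`, `|γ| ≤ Q`. "These appear to be the first explicit log-free zero
density estimates for Dirichlet `L`-functions that do not require `Q` to be 'sufficiently large'."
Not proved here (the proof, §§4–5, is slightly stronger: `1.180016·10^87 (e^{968.1455} Q^99)^{1−σ}`
and `6·10^92`). [cite: ThornerZaman2024LogFree, Theorem 1.2] -/
def thornerZaman2024_theorem12 : Prop :=
  ∀ Q : ℝ, 3 ≤ Q → ∀ σ : ℝ, 39 / 40 ≤ σ →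
    (zeroCount σ Q : ℝ) ≤ 10 ^ 88 * (10 ^ 421 * Q ^ 99) ^ (1 - σ) ∧
      (zeroCountExcl σ Q : ℝ) ≤
        10 ^ 93 * min 1 ((1 - betaOne Q) * Real.log Q) * (10 ^ 466 * Q ^ 170) ^ (1 - σ)

/-- **Thorner–Zaman 2024, Corollary 6.1 (NAMED FACT, as printed).** "Let `Q ≥ 3` and `σ ≥ 0`. With
`N(σ,Q)` and `N*(σ,Q)` as in (1.2), there holds
`N(σ,Q) ≤ 10^{88} (10^{421} Q^{127})^{1−σ}`, `N*(σ,Q) ≤ 10^{93} min{1, (1 − β₁(Q)) log Q} (10^{466} Q^{198})^{1−σ}`."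
(The version used in §6 for Green's power saving in Sárközy's theorem, Theorem 1.1:
`|A| ≪ N^{1 − 1/10^{18}}`.) Not proved here. [cite: ThornerZaman2024LogFree, Corollary 6.1] -/
def thornerZaman2024_corollary61 : Prop :=
  ∀ Q : ℝ, 3 ≤ Q → ∀ σ : ℝ, 0 ≤ σ →
    (zeroCount σ Q : ℝ) ≤ 10 ^ 88 * (10 ^ 421 * Q ^ 127) ^ (1 - σ) ∧
      (zeroCountExcl σ Q : ℝ) ≤
        10 ^ 93 * min 1 ((1 - betaOne Q) * Real.log Q) * (10 ^ 466 * Q ^ 198) ^ (1 - σ)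

/-! ### Elementary bookkeeping (proved) -/

/-- On `39/40 ≤ σ ≤ 1` Corollary 6.1 follows from Theorem 1.2 (larger exponents of `Q ≥ 1`, and
`x ↦ x^{1−σ}` is monotone for `1 − σ ≥ 0`; for `σ > 1` both counts are `0` anyway, not recorded).
[cite: ThornerZaman2024LogFree, Theorem 1.2 and Corollary 6.1] -/
theorem thornerZaman2024_corollary61_of_theorem12_high (h : thornerZaman2024_theorem12) {Q : ℝ}
    (hQ : 3 ≤ Q) {σ : ℝ} (hσ : 39 / 40 ≤ σ) (hσ1 : σ ≤ 1) :
    (zeroCount σ Q : ℝ) ≤ 10 ^ 88 * (10 ^ 421 * Q ^ 127) ^ (1 - σ) ∧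
      (zeroCountExcl σ Q : ℝ) ≤
        10 ^ 93 * min 1 ((1 - betaOne Q) * Real.log Q) * (10 ^ 466 * Q ^ 198) ^ (1 - σ) := by
  obtain ⟨h1, h2⟩ := h Q hQ σ hσ
  have hQ0 : 0 < Q := by linarith
  have hQ1 : 1 ≤ Q := by linarith
  have hexp : 0 ≤ 1 - σ := by linarith
  have h10 : (0 : ℝ) ≤ 10 := by norm_num
  have hpow : ∀ {a b : ℕ}, a ≤ b → Q ^ a ≤ Q ^ b := fun hab => pow_le_pow_right₀ hQ1 hab
  have hmono : ∀ (k : ℕ) {a b : ℕ}, a ≤ b →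
      ((10 : ℝ) ^ k * Q ^ a) ^ (1 - σ) ≤ ((10 : ℝ) ^ k * Q ^ b) ^ (1 - σ) := fun k a b hab =>
    Real.rpow_le_rpow (mul_nonneg (pow_nonneg h10 k) (pow_nonneg hQ0.le a))
      (mul_le_mul_of_nonneg_left (hpow hab) (pow_nonneg h10 k)) hexp
  constructor
  · exact h1.trans (mul_le_mul_of_nonneg_left (hmono 421 (by norm_num)) (pow_nonneg h10 88))
  · rcases le_or_gt 0 (min 1 ((1 - betaOne Q) * Real.log Q)) with hm | hm
    · exact h2.trans
        (mul_le_mul_of_nonneg_left (hmono 466 (by norm_num)) (mul_nonneg (pow_nonneg h10 93) hm))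
    · -- an (impossible) negative middle factor: then `h2` bounds a natural number by a negative real
      have hneg : (10 : ℝ) ^ 93 * min 1 ((1 - betaOne Q) * Real.log Q) *
          ((10 : ℝ) ^ 466 * Q ^ 170) ^ (1 - σ) < 0 := by
        have hbase : 0 < (10 : ℝ) ^ 466 * Q ^ 170 := mul_pos (pow_pos (by norm_num) _) (pow_pos hQ0 _)
        have hp : 0 < ((10 : ℝ) ^ 466 * Q ^ 170) ^ (1 - σ) := Real.rpow_pos_of_pos hbase _
        have : (10 : ℝ) ^ 93 * min 1 ((1 - betaOne Q) * Real.log Q) < 0 :=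
          mul_neg_of_pos_of_neg (pow_pos (by norm_num) _) hm
        exact mul_neg_of_neg_of_pos this hp
      have h0 : (0 : ℝ) ≤ (zeroCountExcl σ Q : ℝ) := Nat.cast_nonneg _
      exact absurd (h0.trans h2) (not_le.2 hneg)

/-! ### The Deuring–Heilbronn factor on a certified range (appended 2026-08-26)

On an exception-free table the factor `min{1, (1 − β₁(Q)) log Q}` of Theorem 1.2 cannot be small: under
`ZeroFreeRegionUpTo Q₀ 10 10` (McCurley's region with `R = 10`, no exception, for all `χ` mod
`3 ≤ q ≤ Q₀` — available from the cell's wide leaves + McCurley's Theorem 1, or from Lu–Zaman–Zhao's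
print theorem) every real zero of a primitive `L(s,χ)`, `q ≤ Q ≤ Q₀`, satisfies
`β ≤ 1 − 1/(10 log Q)` (for `q = 1`, `ζ` has no real zero in `[0, ∞)`: tree `ZetaRealAxis.lean` and
Mathlib's non-vanishing on `Re ≥ 1`), so `β₁(Q) ≤ 1 − 1/(10 log Q)` and `(1 − β₁(Q)) log Q ≥ 1/10`:
BELOW THE TABLE'S HEIGHT THE EXCEPTIONAL-ZERO ENHANCEMENT OF `N*(σ,Q)` IS AT MOST A FACTOR `10`. -/

/-- The set of real zeros of `𝓛(s,Q)` is nonempty once `Q ≥ 1`: `ζ(−2) = 0` (modulus `1`).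
[cite: ThornerZaman2024LogFree, §1 (display defining β₁(Q)) and Remark after Theorem 1.2] -/
theorem ThornerZaman2024.realZeroSet_nonempty {Q : ℝ} (hQ : 1 ≤ Q) : (realZeroSet Q).Nonempty := by
  refine ⟨-2, 0, ?_, (1 : DirichletCharacter ℂ (0 + 1)), ?_, ?_⟩
  · exact Nat.floor_pos.mpr hQ
  · exact DirichletCharacter.isPrimitive_one_level_one
  · rw [DirichletCharacter.LFunction_modOne_eq]
    have h := riemannZeta_neg_two_mul_nat_add_one 0
    norm_num at h
    exact_mod_cast h

/-- **`β₁(Q) ≤ 1 − 1/(10 log Q)` on an exception-free table**: under `ZeroFreeRegionUpTo Q₀ 10 10`,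
for `10 ≤ Q ≤ Q₀` every real zero `β` of a primitive `L(s,χ)` of modulus `q ≤ Q` has
`β ≤ 1 − 1/(10 log Q)` (`q ≥ 3`: the region at `t = 0` reads `σ > 1 − 1/(10 log max(q,10))` and
`max(q,10) ≤ Q`; `q = 2`: no primitive character; `q = 1`: the real zeros of `ζ` are negative).
[cite: ThornerZaman2024LogFree, Theorem 1.2 (the factor min{1,(1−β₁(Q))log Q})] [cite: McCurley1984ZFR, Theorem 1] -/
theorem ThornerZaman2024.betaOne_le_of_zeroFreeRegionUpTo {Q₀ : ℕ} (hZ : ZeroFreeRegionUpTo Q₀ 10 10)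
    {Q : ℝ} (h10 : 10 ≤ Q) (hQ : Q ≤ Q₀) : betaOne Q ≤ 1 - 1 / (10 * Real.log Q) := by
  have hlogQ : 1 < Real.log Q := by
    rw [Real.lt_log_iff_exp_lt (by linarith)]
    have := Real.exp_one_lt_d9
    linarith
  have hlog0 : 0 < Real.log Q := by linarith
  have hbound0 : (0 : ℝ) < 1 - 1 / (10 * Real.log Q) := by
    have : 1 / (10 * Real.log Q) < 1 := by
      rw [div_lt_one (by positivity)]; linarith
    linarith
  apply csSup_le (realZeroSet_nonempty (by linarith))
  rintro β ⟨i, hi, χ, hprim, hzero⟩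
  -- the modulus `q = i + 1 ≤ ⌊Q⌋ ≤ Q`
  have hq : ((i + 1 : ℕ) : ℝ) ≤ Q := by
    have h1 : i + 1 ≤ ⌊Q⌋₊ := hi
    have h2 : ((⌊Q⌋₊ : ℕ) : ℝ) ≤ Q := Nat.floor_le (by linarith)
    exact le_trans (by exact_mod_cast h1) h2
  rcases Nat.lt_or_ge (i + 1) 3 with hsmall | hq3
  · -- modulus 1 or 2
    have hi01 : i = 0 ∨ i = 1 := by omega
    rcases hi01 with rfl | rfl
    · -- `q = 1`: `ζ`; its real zeros are negative
      have hζ : riemannZeta β = 0 := by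
        rwa [DirichletCharacter.LFunction_modOne_eq] at hzero
      by_contra hlt
      rw [not_le] at hlt
      have hβ0 : 0 < β := lt_trans hbound0 hlt
      rcases lt_or_ge β 1 with hβ1 | hβ1
      · exact riemannZeta_ofReal_ne_zero_of_pos_of_lt_one β hβ0 hβ1 hζ
      · exact riemannZeta_ne_zero_of_one_le_re (by simpa using hβ1) hζ
    · -- `q = 2`: every character mod `2` is trivial (one unit), hence of conductor `1`, imprimitive
      exfalso
      have hsub : Subsingleton (ZMod (1 + 1))ˣ := by
        refine Fintype.card_le_one_iff_subsingleton.mp ?_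
        rw [ZMod.card_units_eq_totient]
        decide
      have hχ : χ = 1 :=
        MulChar.ext fun a => by rw [Subsingleton.elim a 1, Units.val_one, map_one, map_one]
      rw [DirichletCharacter.isPrimitive_def, hχ, DirichletCharacter.conductor_one] at hprim
      omega
  · -- `q ≥ 3`: the exception-free region at the real point `β`
    haveI : NeZero (i + 1) := ⟨by omega⟩
    by_contra hlt
    rw [not_le] at hlt
    have hne1 : (β : ℂ) ≠ 1 := by
      intro h
      have hβ1 : β = 1 := by exact_mod_cast h
      have hq2 : 2 ≤ i + 1 := by omega
      have hχne : χ ≠ 1 := SiegelZeroQuality.ne_one_of_isPrimitive hprim hq2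
      exact DirichletCharacter.LFunction_ne_zero_of_one_le_re χ (Or.inl hχne)
        (by rw [h, Complex.one_re]) hzero
    have hqQ₀ : i + 1 ≤ Q₀ := by
      have : ((i + 1 : ℕ) : ℝ) ≤ (Q₀ : ℝ) := hq.trans hQ
      exact_mod_cast this
    refine hZ (i + 1) hq3 hqQ₀ χ (β : ℂ) hne1 ?_ hzero
    -- `1 − 1/(10 log max(max q (q·|Im β|)) 10) ≤ 1 − 1/(10 log Q) < β`
    have hmax : max (max ((i + 1 : ℕ) : ℝ) (((i + 1 : ℕ) : ℝ) * |(β : ℂ).im|)) 10 ≤ Q := by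
      rw [Complex.ofReal_im, abs_zero, mul_zero]
      refine max_le (max_le hq ?_) h10
      have : (0 : ℝ) ≤ ((i + 1 : ℕ) : ℝ) := by positivity
      linarith
    have hmax10 : (10 : ℝ) ≤ max (max ((i + 1 : ℕ) : ℝ) (((i + 1 : ℕ) : ℝ) * |(β : ℂ).im|)) 10 :=
      le_max_right _ _
    have hlogmax : Real.log (max (max ((i + 1 : ℕ) : ℝ) (((i + 1 : ℕ) : ℝ) * |(β : ℂ).im|)) 10) ≤
        Real.log Q := Real.log_le_log (by linarith) hmax
    have hlogmax0 : 0 < Real.log (max (max ((i + 1 : ℕ) : ℝ) (((i + 1 : ℕ) : ℝ) * |(β : ℂ).im|)) 10) := by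
      have : 1 < Real.log (max (max ((i + 1 : ℕ) : ℝ) (((i + 1 : ℕ) : ℝ) * |(β : ℂ).im|)) 10) := by
        rw [Real.lt_log_iff_exp_lt (by linarith)]
        have := Real.exp_one_lt_d9
        linarith
      linarith
    have hcmp : 1 / (10 * Real.log Q) ≤
        1 / (10 * Real.log (max (max ((i + 1 : ℕ) : ℝ) (((i + 1 : ℕ) : ℝ) * |(β : ℂ).im|)) 10)) :=
      one_div_le_one_div_of_le (by positivity) (by nlinarith)
    rw [Complex.ofReal_re]
    linarith

/-- **The Deuring–Heilbronn factor is `≥ 1/10` on `[10, Q₀]` under an exception-free table**: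
`1/10 ≤ min{1, (1 − β₁(Q)) log Q}` for `10 ≤ Q ≤ Q₀` under `ZeroFreeRegionUpTo Q₀ 10 10`.
[cite: ThornerZaman2024LogFree, Theorem 1.2] [cite: McCurley1984ZFR, Theorem 1] -/
theorem ThornerZaman2024.tenth_le_dhFactor_of_zeroFreeRegionUpTo {Q₀ : ℕ}
    (hZ : ZeroFreeRegionUpTo Q₀ 10 10) {Q : ℝ} (h10 : 10 ≤ Q) (hQ : Q ≤ Q₀) :
    1 / 10 ≤ min 1 ((1 - betaOne Q) * Real.log Q) := by
  have hlogQ : 1 < Real.log Q := by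
    rw [Real.lt_log_iff_exp_lt (by linarith)]
    have := Real.exp_one_lt_d9
    linarith
  have hβ := betaOne_le_of_zeroFreeRegionUpTo hZ h10 hQ
  refine le_min (by norm_num) ?_
  have h1 : 1 / (10 * Real.log Q) ≤ 1 - betaOne Q := by linarith
  calc (1 : ℝ) / 10 = 1 / (10 * Real.log Q) * Real.log Q := by field_simp
    _ ≤ (1 - betaOne Q) * Real.log Q := mul_le_mul_of_nonneg_right h1 (by linarith)

/-- **Instance `Q₀ = 10¹⁰`, CERTIFIED-NUMERICS version** (leaf `NoRealZeroUpTo_1e10` of the cell +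
McCurley's Theorem 1): for `10 ≤ Q ≤ 10¹⁰`, `1/10 ≤ min{1, (1 − β₁(Q)) log Q}` — below the table's
height Theorem 1.2's exceptional-zero enhancement is at most a factor `10`.
[cite: ThornerZaman2024LogFree, Theorem 1.2] [cite: McCurley1984ZFR, Theorem 1] -/
theorem ThornerZaman2024.tenth_le_dhFactor_upTo_1e10_of_leaf (hW : NoRealZeroUpTo_1e10)
    (hM : McCurley1984_theorem1) {Q : ℝ} (h10 : 10 ≤ Q) (hQ : Q ≤ 10 ^ 10) :
    1 / 10 ≤ min 1 ((1 - betaOne Q) * Real.log Q) := by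
  have hN : NoExceptionalZeroUpTo 10000000000 (1 / 10) :=
    NoRealZeroUpTo.noExceptionalZeroUpTo hW (1 / 10)
  have hZ : ZeroFreeRegionUpTo 10000000000 10 10 :=
    zeroFreeRegionUpTo_of_noExceptionalZeroUpTo hM (by norm_num) hN (by norm_num) (by norm_num)
      (by norm_num)
  exact tenth_le_dhFactor_of_zeroFreeRegionUpTo hZ h10 (by norm_num at hQ ⊢; exact hQ)

/-- **Instance `Q₀ = 10¹⁰`, PRINT version** (Lu–Zaman–Zhao's Theorem 1.1 + McCurley's Theorem 1).
[cite: LuZamanZhao2026, Theorem 1.1] [cite: McCurley1984ZFR, Theorem 1] -/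
theorem ThornerZaman2024.tenth_le_dhFactor_upTo_1e10 (h11 : luZamanZhao2026_theorem11)
    (hM : McCurley1984_theorem1) {Q : ℝ} (h10 : 10 ≤ Q) (hQ : Q ≤ 10 ^ 10) :
    1 / 10 ≤ min 1 ((1 - betaOne Q) * Real.log Q) := by
  have hN : NoExceptionalZeroUpTo (10 ^ 10) (1 / 5) := noExceptionalZeroUpTo_of_luZamanZhao h11
  have hZ : ZeroFreeRegionUpTo (10 ^ 10) 10 10 :=
    zeroFreeRegionUpTo_of_noExceptionalZeroUpTo hM (by norm_num) hN (by norm_num) (by norm_num)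
      (by norm_num)
  exact tenth_le_dhFactor_of_zeroFreeRegionUpTo hZ h10 (by norm_num at hQ ⊢; exact hQ)

end Literature.NumberTheory.LFunctions

end
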